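import Summits.ResolutionOfSingularities.ResolutionOfSingularities.Theses.FrobeniusLadder
import Summits.ResolutionOfSingularities.ResolutionOfSingularities.Theorems.FrobeniusLadderFInjectiveMacaulayficationTrOfResolutionFull
import Summits.ResolutionOfSingularities.ResolutionOfSingularities.Theorems.FrobeniusLadderFInjectiveMacaulayficationOfTrRungs
import HarnessLib

/-!
# Crux `FInjectiveMacaulayfication` (stmt-ResolutionOfSingularities-15315) — LINE v39-FL «FULL-LADDER DOOR» (second line of record BY EVIDENCE alongside the REGISTERED skeleton v38
# «closed-point door» `4c41af8f694fab1a`, not replacing it; res-L1-w45a-plan-1 RULINGS R18.5 (2) 2026-08-28T07:48:52Z and R18.7 07:53:38Z; text prepared by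
# res-L1-w45a-stub-3 g9 (draft sha16 31107f5e1259cd1d), V-READ PASS by res-L1-w45a-tri-2 g14 08:05:14Z, published by res-L1-w45a-lead-1 g8 after the LEMMA N♭ assembly p613893)

[OURS · L1 W4.5a] Line file of record BY EVIDENCE (R18.7: published by `ledger crux write stmt-ResolutionOfSingularities-15315 Lines/full-ladder.lean|.md` + item evidence;
NO `ledger skeleton check` — the ledger keeps one skeleton per item and v38 stays registered); sorries ONLY in `stub_*`; the deciding theorem
`FInjectiveMacaulayfication_of` (alias `FInjectiveMacaulayfication_proof`) concludes the route decl BY NAME. AI-written (AI review is weaker than expert review).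

THE LINE. v38 factors the crux through four published theorems, the resolution rungs T(p,e,1) = `ClosedPointLocalResolutionAdmTr p e 1` (e ≥ 4) and the F-half.
res-L1-w45a-stub-3 g9 showed in the kernel (p612760 `TrOfResolution`, p613542 `TrOfResolutionFull`):
  T(p,e,r) ⟸ `ResolutionTr p e r` (resolution of e-folds over k(X₁..X_r); Temkin 2008 Prop. 2.3.4 (ii)⇒(iii) localized) ⟸ `FullBlowupTr p e r` ∧ `ResolutionFullTr p e r`
  (Temkin Lemma 2.1.4 = Stacks 080B), and `FullBlowupTr p e r` is a THEOREM from the prints ∧ {T(p,e′,·)}_{e′<e} ∧ F(e) (`DimSliceCM` engine);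
hence by STRONG INDUCTION ON THE LEVEL the whole resolution side is carried by **`ResolutionFullTr p e 1`, e ≥ 4: resolution (Temkin Def. 2.2.6: ONE blowing up with
centre in the singular locus and regular source) of FULL — locally integral ∧ Cohen–Macaulay ∧ parameter ideals Frobenius-closed, i.e. F-injective CM — integral
separated finite-type e-folds over k(s), ONE transcendental, k any field of characteristic p** (`r = 1` by res-L1-w45a-lead-1's tower isomorphism, `resolutionFullTr_mono`).
RESIDUE READING: «crux ⟸ {CP 2019 Thm 1.1, Stacks 081R, CP 2019 Prop 4.4, Česnavičius 2021 Thm 5.3 (B)} ∧ F-half `LocalFInjectivizationFibreAdmGe4` ∧ resolution of FULL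
e-folds over k(s), e ≥ 4» — after the F-half the resolution side NEVER SEES A NON-FULL GERM: every informative row of the F-half census (P2d4C p610550, P2d4F5 p612829,
P2d4B, T⁽⁴⁾/7 p601374, z² = Fermat cubic p600638) has a non-FULL germ and lies outside stub 2's input class. PER DIMENSION (`TrOfResolutionFull`): dim ≤ 4 ⟸ prints ∧ F(4)
(unchanged, no resolution input); dim ≤ 5 ⟸ prints ∧ F(4) ∧ F(5) ∧ `ResolutionFullTr p 4 1` (`…_dimLe5_of_cesnaviciusOffClosed_of_resolutionFull41_of_F45`).
HONEST CAVEATS (res-L1-w45a-stub-3 l.79341 (iv), verbatim): «modulo the F-half, ResolutionFullTr ≡ ResolutionTr in strength; FULL ⊋ F-rational so this is NOT rung 15317;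
resolution of F-injective CM 4-folds over imperfect fields is OPEN; ResolutionFullTr ⇒ T kernel, converse not». Relation to v38 (bundle policy l.78869 / R18.5 (2)):
a NEW residue cut in content (smaller input class on the resolution side; mechanism = induction on the level), not a re-lettering; v38's hypotheses remain the weaker
ones in the kernel (`ResolutionFullTr p e 1` ⇒ T(p,e,1) given prints ∧ F, `TrOfResolutionFull.stubTr_of_cesnaviciusOffClosed_of_LFadmF_of_resolutionFull`; converse not a
tree theorem). Route-level reading (R18.3, kernel p614714 `AdmRungs`): `ResolutionFullTr` ⟸ the route's own rungs #3 `FRationalModification`, #4 `FRationalResolution`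
one dimension down TAKEN ADMISSIBLY (`AdmRungs.resolutionFullTr_of_admRungs`); the weak items as typed do not suffice.
Dossier: `Lines/full-ladder.md`.
-/

-- single-problem summit: the doubled namespace component is forced
set_option linter.dupNamespace false

noncomputable section

namespace Summit.ResolutionOfSingularities.ResolutionOfSingularities.Cruxes.FInjectiveMacaulayfication.FullLadder

open AlgebraicGeometry CategoryTheory Literature.AlgebraicGeometry.Resolution

/-- NAMED FACTS BY NAME (the ONE named-fact stub, NEVER a prover target; byte-identical to v38's): Cossart–Piltant 2019 Thm 1.1 (`CossartPiltant2019General`) ·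
Raynaud–Gruson flattening = Stacks 081R (`Stacks081R`) · Cossart–Piltant 2019 Prop 4.4 (`CossartPiltant2019Principalization`) · Česnavičius 2021 Thm 5.3 reading (B)
(`CesnaviciusBlowupMacaulayficationOffClosed`, Literature p602953, admitted DR-CZ3). [cite: CossartPiltant2019, Thm. 1.1; Prop. 4.4] [cite: StacksProject, Tag 081R]
[cite: Cesnavicius2021, Thm. 5.3] -/
theorem stub_namedFacts :
    Literature.AlgebraicGeometry.Resolution.CossartPiltant2019General.{0} ∧ Literature.AlgebraicGeometry.Resolution.Stacks081R.{0} ∧ Literature.AlgebraicGeometry.Resolution.CossartPiltant2019Principalization.{0} ∧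
      Literature.AlgebraicGeometry.Resolution.CesnaviciusBlowupMacaulayficationOffClosed.{0} := by
  sorry

/-- STUB (RF₁) — **RESOLUTION OF FULL `e`-FOLDS OVER `k(s)`, `e ≥ 4`, ONE TRANSCENDENTAL** (`TrOfResolutionFull.ResolutionFullTr p e 1` BY NAME, res-L1-w45a-stub-3 p613542):
for every prime `p`, every `e ≥ 4`, every field `k` of characteristic `p`, every INTEGRAL separated finite-type scheme `Y` over `K := FractionRing (MvPolynomial (Fin 1) k)`
with `dim Y = e` ALL OF WHOSE STALKS ARE FULL (`SliceableCentre.FullCl p`: domain ∧ every s.o.p. weakly regular ∧ parameter ideals Frobenius-closed): `Y` admits a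
desingularization (`Scheme.AdmitsDesingularization`: ONE blowing up with centre inside `Sing Y` and regular source, Temkin Def. 2.2.6). IMPLIES v38's resolution stub
given the prints and the F-half (`TrOfResolutionFull.stubTr_of_cesnaviciusOffClosed_of_LFadmF_of_resolutionFull` + `forall_resolutionFullTr_of_one`); the converse is not a
tree theorem. Vacuous on 4-folds (only `e ≤ dim X − 1` is consumed); on 5-folds exactly `ResolutionFullTr p 4 1`. Open for every `e ≥ 4`.
[conjecture · OURS · v39-FL stub] -/
theorem stub_resolutionFullTrOne :
    ∀ p e : ℕ, p.Prime → 4 ≤ e →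
      Summit.ResolutionOfSingularities.ResolutionOfSingularities.Theorems.FInjectiveMacaulayfication.TrOfResolutionFull.ResolutionFullTr p e 1 := by
  sorry

/-- STUB (F_adm) — **LOCAL F-INJECTIVIZATION OF COHEN–MACAULAY ADMISSIBLE BLOW-UPS AT CLOSED SINGULAR POINTS, FIBRE-SUPPORTED CENTRE, EVERY LOCAL DIMENSION d ≥ 4**
(`LocalFullificationFibreAdmGe4Split.LocalFInjectivizationFibreAdmGe4` BY NAME, res-L1-w45a-stub-2 p591179; byte-identical to v38's stub): at a CLOSED point `x ∉ Reg X` with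
`dim 𝒪_{X,x} = d ≥ 4` (`X` integral separated f.t./k, char p), a blowing up `S′` of `Spec 𝒪_{X,x}` along `I ≠ ⊥` with `supp I ⊆ (Reg Spec 𝒪_{X,x})ᶜ`, regular off its
closed fibre and Cohen–Macaulay at EVERY point, admits `𝓚 ≠ ⊥` supported in the closed fibre all of whose blowing ups are FULL at every point. Positive kernel rows:
three informative F(4)-iso rows at p = 2 (P2d4C, P2d4F5, P2d4B), T⁽⁴⁾/7, Fermat cubic cones; F(d)-pos: candidate mechanism the τ-tower (evidence level). No counterexample
known. [conjecture · OURS · v37/v38/v39-FL registered stub] -/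
theorem stub_localFInjectivizationFibreAdmGe4 :
    Summit.ResolutionOfSingularities.ResolutionOfSingularities.Theorems.FInjectiveMacaulayfication.LocalFullificationFibreAdmGe4Split.LocalFInjectivizationFibreAdmGe4 := by
  sorry

/-- **THE DECIDING THEOREM (v39-FL, full-ladder door)**: the crux `FInjectiveMacaulayfication` BY NAME from the named bundle `stub_namedFacts` (CP 1.1, 081R, CP 4.4,
Česnavičius 5.3 (B)), the F-half (F_adm) and resolution of FULL `e`-folds over `k(s)` (RF₁), by res-L1-w45a-stub-3's
`TrOfResolutionFull.fInjectiveMacaulayfication_of_cesnaviciusOffClosed_of_LFadmF_of_resolutionFullOne` (p613542; strong induction on the level over v38's assembly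
`OfTrRungs.fInjectiveMacaulayfication_of_trRungs_of_cesnaviciusOffClosed`). [OURS assembly; v39-FL] -/
theorem FInjectiveMacaulayfication_of :
    Summit.ResolutionOfSingularities.ResolutionOfSingularities.Theses.FrobeniusLadder.FInjectiveMacaulayfication :=
  Summit.ResolutionOfSingularities.ResolutionOfSingularities.Theorems.FInjectiveMacaulayfication.TrOfResolutionFull.fInjectiveMacaulayfication_of_cesnaviciusOffClosed_of_LFadmF_of_resolutionFullOne
    stub_namedFacts.1 stub_namedFacts.2.1 stub_namedFacts.2.2.1 stub_namedFacts.2.2.2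
    stub_localFInjectivizationFibreAdmGe4 stub_resolutionFullTrOne

/-- The same deciding term under v38's name convention. [OURS assembly; v39-FL] -/
theorem FInjectiveMacaulayfication_proof :
    Summit.ResolutionOfSingularities.ResolutionOfSingularities.Theses.FrobeniusLadder.FInjectiveMacaulayfication :=
  FInjectiveMacaulayfication_of

/-- AUDIT TWIN 1 (sorry-free given the stubs' statements as hypotheses): v39-FL's residue IMPLIES v38's — the T-rungs from (RF₁), the prints and the F-half
(`TrOfResolutionFull.stubTr_of_cesnaviciusOffClosed_of_LFadmF_of_resolutionFull` ∘ `forall_resolutionFullTr_of_one`), then v38's assembly. [OURS · plumbing; v39-FL] -/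
theorem FInjectiveMacaulayfication_via_v38
    (hF : Literature.AlgebraicGeometry.Resolution.CossartPiltant2019General.{0} ∧ Literature.AlgebraicGeometry.Resolution.Stacks081R.{0} ∧
      Literature.AlgebraicGeometry.Resolution.CossartPiltant2019Principalization.{0} ∧ Literature.AlgebraicGeometry.Resolution.CesnaviciusBlowupMacaulayficationOffClosed.{0})
    (hRF1 : ∀ p e : ℕ, p.Prime → 4 ≤ e →
      Summit.ResolutionOfSingularities.ResolutionOfSingularities.Theorems.FInjectiveMacaulayfication.TrOfResolutionFull.ResolutionFullTr p e 1)
    (hFadm : Summit.ResolutionOfSingularities.ResolutionOfSingularities.Theorems.FInjectiveMacaulayfication.LocalFullificationFibreAdmGe4Split.LocalFInjectivizationFibreAdmGe4) :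
    Summit.ResolutionOfSingularities.ResolutionOfSingularities.Theses.FrobeniusLadder.FInjectiveMacaulayfication :=
  Summit.ResolutionOfSingularities.ResolutionOfSingularities.Theorems.FInjectiveMacaulayfication.OfTrRungs.fInjectiveMacaulayfication_of_trRungs_of_cesnaviciusOffClosed
    hF.1 hF.2.1 hF.2.2.1 hF.2.2.2
    (Summit.ResolutionOfSingularities.ResolutionOfSingularities.Theorems.FInjectiveMacaulayfication.TrOfResolutionFull.stubTr_of_cesnaviciusOffClosed_of_LFadmF_of_resolutionFull
      hF.1 hF.2.1 hF.2.2.1 hF.2.2.2 hFadm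
      (Summit.ResolutionOfSingularities.ResolutionOfSingularities.Theorems.FInjectiveMacaulayfication.TrOfResolutionFull.forall_resolutionFullTr_of_one hRF1))
    hFadm

end Summit.ResolutionOfSingularities.ResolutionOfSingularities.Cruxes.FInjectiveMacaulayfication.FullLadder

end
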